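import Mathlib.AlgebraicGeometry.EllipticCurve.DivisionPolynomial.Basic
import Mathlib.AlgebraicGeometry.EllipticCurve.VariableChange
import Mathlib.NumberTheory.Padics.Hensel
import Mathlib.NumberTheory.Padics.RingHoms
import HarnessLib

/-!
# From a rootless `Ψ₃` to the two Kummer shapes at `3` (Hensel contrapositives over `ℤ₃`)
# (cell `b2b-bsdres`, team n1011, row T-SSQ3, seat n1011-p05 GEN 11, FILE F3a — class-free TOOL)

HONEST FRAMING (cell `b2b-bsdres`, run/shared/lean/b2b/bsd-rank1-residual/, verbatim in every
file): the goal of the cell is to DELETE the COMBINATION-SHAPED residual classes of the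
Birch–Swinnerton-Dyer formula for ALL analytic-rank `≤ 1` elliptic curves over `ℚ` — "full BSD
formula for every rank `≤ 1` curve in class `C`" assembled STRICTLY from published theorems — so
that the rank-`≤ 1` remainder becomes exactly the CONSTRUCTION-SHAPED classes, which are TYPED
(missing-input `Prop`s), NOT attempted. This is not "finishing BSD". Team n1011; row T-SSQ3
(`cells/n1011/skel/T-SSQ3.md`) = a KERNEL proof of the O5 cell's node T19a
`O5.SupersingularLocalClassUniqueThree`. This file: TOOL theorems over `ℤ₃` only — no definition, no
named fact, no `sorry`; nothing about any particular curve; nothing booked.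

## What

`Ψ₃ = 3x⁴ + b₂x³ + 3b₄x² + 3b₆x + b₈`. For a Weierstrass model `M` over `ℤ₃` whose `Ψ₃` has NO
root in `ℚ₃` (`E[3]|G_{ℚ₃}` irreducible), Hensel's lemma in `ℤ₃` (Mathlib `hensels_lemma`) forces
divisibilities — these are the inputs of the two shapes of FILE F2b `PsiThreeKummerQuarticShapes`:

* `exists_root_of_unitCubeShape` — `z⁴ + uz³ + 3d₂z² + 3d₁z + 3d₀` with `u ∈ ℤ₃ˣ` has a root in `ℤ₃`
  (Hensel at `z = −u`).
* (G) `three_dvd_b₂_of_forall_not_isRoot` — rootless `Ψ₃` ⟹ `3 ∣ b₂` (else `27·Ψ₃(w/3) =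
  w⁴ + b₂w³ + 9b₄w² + 27b₆w + 27b₈` has a root); `three_dvd_b₈_add_one` — `3 ∣ b₂` and `Δ ∈ ℤ₃ˣ` ⟹
  `b₈ ≡ −1 (mod 3)` (`Δ ≡ −8b₄³`, `4b₈ = b₂b₆ − b₄²`, a computation in `ℤ/3`): the GOOD SUPERSINGULAR
  shape.
* (T) `IIIstarForm.b₂_eq` … `b₈_eq` — on Tate's normal form of type `III*` (`a₁ = 3α₁, a₂ = 9α₂,
  a₃ = 27α₃, a₄ = 27α₄, a₆ = 243α₆`) `b₂ = 9(…), b₄ = 27(…), b₆ = 243(…), b₈ = 729β₈` with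
  `β₈ ≡ −α₄² (mod 3)`, so `3 ∣ β₈ + 1` when `α₄` is a unit (`IIIstarForm.three_dvd_β₈_add_one`);
  `three_dvd_of_IIIstarForm_of_forall_not_isRoot` — rootless `Ψ₃` ⟹ `27 ∣ b₂` (else
  `Ψ₃(3w)/3⁵ = w⁴ + (b₂/9)w³ + …` has a root): the `III*` shape.

References: J. H. Silverman, *AEC* III.1, Ex. 3.7; *ATAEC* IV.9.4 Step 9 [SilvermanAEC2009]
[SilvermanATAEC1994]; K. Conrad, *Hensel's lemma* (Mathlib `hensels_lemma`) [folklore];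
cells/n1011/skel/T-SSQ3.md.
-/

noncomputable section

open Polynomial

namespace Summit.BirchSwinnertonDyer.Rank1Residual.GaloisImage.PsiThreeKummer

/-! ## §1 Units of `ℤ₃` and a Hensel root -/

/-- A unit plus a multiple of `3` is a unit of `ℤ₃`. [folklore] -/
theorem isUnit_add_three_mul {u : ℤ_[3]} (hu : IsUnit u) (k : ℤ_[3]) : IsUnit (u + 3 * k) := by
  by_contra h
  have hm : u + 3 * k ∈ IsLocalRing.maximalIdeal ℤ_[3] := (IsLocalRing.mem_maximalIdeal _).mpr h
  have h3 : (3 : ℤ_[3]) * k ∈ IsLocalRing.maximalIdeal ℤ_[3] := by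
    rw [PadicInt.maximalIdeal_eq_span_p, Ideal.mem_span_singleton]
    exact ⟨k, by norm_num⟩
  have : u ∈ IsLocalRing.maximalIdeal ℤ_[3] := by simpa using Ideal.sub_mem _ hm h3
  exact (IsLocalRing.mem_maximalIdeal _).mp this hu

/-- `3 ∤ x` in `ℤ₃` iff `x` is a unit. [folklore] -/
theorem isUnit_iff_not_three_dvd (x : ℤ_[3]) : IsUnit x ↔ ¬ (3 : ℤ_[3]) ∣ x := by
  rw [PadicInt.isUnit_iff]
  have h := PadicInt.norm_le_one x
  have h' : ‖x‖ < 1 ↔ (3 : ℤ_[3]) ∣ x := by exact_mod_cast PadicInt.norm_lt_one_iff_dvd x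
  constructor
  · intro h1 h3; rw [← h'] at h3; linarith
  · intro h3; by_contra h1; exact h3 (h'.mp (lt_of_le_of_ne h h1))

/-- **Hensel root of the unit-cube shape**: `z⁴ + uz³ + 3d₂z² + 3d₁z + 3d₀` with `u` a unit of `ℤ₃`
has a root in `ℤ₃` — at `a = −u` the value is `3(d₂u² − d₁u + d₀)` (norm `≤ 1/3`) and the
derivative is `−u³ + 3(−2d₂u + d₁)`, a unit (Mathlib `hensels_lemma`). [folklore] -/
theorem exists_root_of_unitCubeShape {u : ℤ_[3]} (hu : IsUnit u) (d₀ d₁ d₂ : ℤ_[3]) :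
    ∃ z : ℤ_[3], z ^ 4 + u * z ^ 3 + 3 * d₂ * z ^ 2 + 3 * d₁ * z + 3 * d₀ = 0 := by
  set F : ℤ_[3][X] := X ^ 4 + Polynomial.C u * X ^ 3 + Polynomial.C (3 * d₂) * X ^ 2 +
    Polynomial.C (3 * d₁) * X + Polynomial.C (3 * d₀) with hF
  have hval : F.aeval (-u) = 3 * (d₂ * u ^ 2 - d₁ * u + d₀) := by
    rw [hF]
    simp only [map_add, map_mul, map_pow, aeval_X, aeval_C, Algebra.algebraMap_self, RingHom.id_apply]
    ring
  have hder : F.derivative.aeval (-u) = -u ^ 3 + 3 * (-(2 * d₂ * u) + d₁) := by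
    rw [hF]
    simp only [derivative_mul, derivative_X_pow, derivative_C, derivative_X,
      zero_mul, zero_add, mul_one, map_add, map_mul, map_pow, map_natCast, map_zero,
      aeval_X, aeval_C, Algebra.algebraMap_self, RingHom.id_apply]
    push_cast
    ring
  have hunit : IsUnit (F.derivative.aeval (-u)) := by
    rw [hder]
    exact isUnit_add_three_mul (hu.pow 3).neg _
  have hnorm : ‖F.aeval (-u)‖ < ‖F.derivative.aeval (-u)‖ ^ 2 := by
    rw [PadicInt.isUnit_iff.mp hunit, one_pow, hval]
    have h3 : ‖(3 : ℤ_[3])‖ < 1 := by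
      have := (PadicInt.norm_lt_one_iff_dvd (3 : ℤ_[3])).mpr (by exact_mod_cast dvd_refl (3 : ℤ_[3]))
      exact this
    calc ‖(3 : ℤ_[3]) * (d₂ * u ^ 2 - d₁ * u + d₀)‖
        = ‖(3 : ℤ_[3])‖ * ‖d₂ * u ^ 2 - d₁ * u + d₀‖ := norm_mul _ _
      _ ≤ ‖(3 : ℤ_[3])‖ * 1 := by gcongr; exact PadicInt.norm_le_one _
      _ < 1 := by rw [mul_one]; exact h3
  obtain ⟨z, hz, -⟩ := hensels_lemma hnorm
  refine ⟨z, ?_⟩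
  rw [hF] at hz
  simpa only [map_add, map_mul, map_pow, aeval_X, aeval_C, Algebra.algebraMap_self,
    RingHom.id_apply] using hz

/-! ## §2 (G) Rootless `Ψ₃` forces `3 ∣ b₂`; with `Δ` a unit, `b₈ ≡ −1 (mod 3)` -/

section Good

variable (M : WeierstrassCurve ℤ_[3])

/-- `Ψ₃` of the base change to `ℚ₃`, evaluated at `z/3` for `z ∈ ℤ₃`:
`27 · Ψ₃(z/3) = z⁴ + b₂z³ + 9b₄z² + 27b₆z + 27b₈`. [folklore] -/
theorem eval_Ψ₃_div_three (z : ℤ_[3]) :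
    27 * (M.map (algebraMap ℤ_[3] ℚ_[3])).Ψ₃.eval (algebraMap ℤ_[3] ℚ_[3] z / 3) =
      algebraMap ℤ_[3] ℚ_[3]
        (z ^ 4 + M.b₂ * z ^ 3 + 3 * (3 * M.b₄) * z ^ 2 + 3 * (9 * M.b₆) * z + 3 * (9 * M.b₈)) := by
  simp only [WeierstrassCurve.Ψ₃, WeierstrassCurve.map_b₂, WeierstrassCurve.map_b₄,
    WeierstrassCurve.map_b₆, WeierstrassCurve.map_b₈, eval_add, eval_mul, eval_pow, eval_C, eval_X,
    eval_ofNat, map_add, map_mul, map_pow, map_ofNat]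
  field_simp
  ring

/-- **Rootless `Ψ₃` forces `3 ∣ b₂`** (the reduction at a good `3` is then SUPERSINGULAR): if `b₂`
were a unit, `w⁴ + b₂w³ + 9b₄w² + 27b₆w + 27b₈` would have a Hensel root `w ∈ ℤ₃`, and `w/3` would be
a root of `Ψ₃` in `ℚ₃`. [folklore] -/
theorem three_dvd_b₂_of_forall_not_isRoot
    (h : ∀ r : ℚ_[3], ¬ ((M.map (algebraMap ℤ_[3] ℚ_[3])).Ψ₃).IsRoot r) : (3 : ℤ_[3]) ∣ M.b₂ := by
  by_contra hnd
  have hu : IsUnit M.b₂ := (isUnit_iff_not_three_dvd _).mpr hnd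
  obtain ⟨z, hz⟩ := exists_root_of_unitCubeShape hu (9 * M.b₈) (9 * M.b₆) (3 * M.b₄)
  refine h (algebraMap ℤ_[3] ℚ_[3] z / 3) ?_
  have h27 := eval_Ψ₃_div_three M z
  rw [hz, map_zero] at h27
  exact (mul_eq_zero.mp h27).resolve_left (by norm_num)

/-- The `ℤ/3`-computation behind `b₈ ≡ −1`: if `x₂ = 0`, `δ = −x₂²x₈ − 8x₄³ − 27x₆² + 9x₂x₄x₆ ≠ 0`
and `4x₈ = x₂x₆ − x₄²` in `ℤ/3`, then `x₈ + 1 = 0`. [folklore] -/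
theorem zmod3_b₈_add_one (x₂ x₄ x₆ x₈ : ZMod 3) (h2 : x₂ = 0)
    (hΔ : -x₂ ^ 2 * x₈ - 8 * x₄ ^ 3 - 27 * x₆ ^ 2 + 9 * x₂ * x₄ * x₆ ≠ 0)
    (hrel : 4 * x₈ = x₂ * x₆ - x₄ ^ 2) : x₈ + 1 = 0 := by
  subst h2
  revert x₄ x₆ x₈
  decide

/-- `3 ∣ x` in `ℤ₃` iff `x` reduces to `0` in `ℤ/3`. [folklore] -/
theorem three_dvd_iff_toZMod_eq_zero (x : ℤ_[3]) :
    (3 : ℤ_[3]) ∣ x ↔ PadicInt.toZMod x = 0 := by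
  rw [← RingHom.mem_ker, PadicInt.ker_toZMod, PadicInt.maximalIdeal_eq_span_p,
    Ideal.mem_span_singleton]
  norm_cast

/-- **`3 ∣ b₂` and `Δ ∈ ℤ₃ˣ` force `b₈ ≡ −1 (mod 3)`**: modulo `3`, `Δ ≡ −8b₄³ ≠ 0` so `b₄ ≢ 0`,
`b₄² ≡ 1`, and `4b₈ = b₂b₆ − b₄²` gives `b₈ ≡ −1`. [folklore] -/
theorem three_dvd_b₈_add_one (h2 : (3 : ℤ_[3]) ∣ M.b₂) (hΔ : IsUnit M.Δ) :
    (3 : ℤ_[3]) ∣ M.b₈ + 1 := by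
  rw [three_dvd_iff_toZMod_eq_zero] at h2 ⊢
  rw [map_add, map_one]
  refine zmod3_b₈_add_one (PadicInt.toZMod M.b₂) (PadicInt.toZMod M.b₄) (PadicInt.toZMod M.b₆)
    (PadicInt.toZMod M.b₈) h2 ?_ ?_
  · have hΔ' := (hΔ.map (PadicInt.toZMod (p := 3))).ne_zero
    simpa only [WeierstrassCurve.Δ, map_add, map_sub, map_neg, map_mul, map_pow, map_ofNat]
      using hΔ'
  · have h := congrArg (PadicInt.toZMod (p := 3)) M.b_relation
    simpa only [map_mul, map_sub, map_pow, map_ofNat] using h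

end Good

/-! ## §3 (T) Tate's normal form of type `III*`: the `b`'s, and rootless `Ψ₃` forces `27 ∣ b₂` -/

section IIIstar

variable (M : WeierstrassCurve ℤ_[3]) {α₁ α₂ α₃ α₄ α₆ : ℤ_[3]} (ha₁ : M.a₁ = 3 * α₁)
  (ha₂ : M.a₂ = 9 * α₂) (ha₃ : M.a₃ = 27 * α₃) (ha₄ : M.a₄ = 27 * α₄) (ha₆ : M.a₆ = 243 * α₆)
include ha₁ ha₂ ha₃ ha₄ ha₆

omit ha₃ ha₄ ha₆ in
/-- On the `III*` form, `b₂ = 9(α₁² + 4α₂)`. [cite: SilvermanATAEC1994, IV.9.4 Step 9] -/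
theorem IIIstarForm.b₂_eq : M.b₂ = 9 * (α₁ ^ 2 + 4 * α₂) := by
  rw [WeierstrassCurve.b₂, ha₁, ha₂]; ring

omit ha₂ ha₆ in
/-- On the `III*` form, `b₄ = 27(2α₄ + 3α₁α₃)`. [cite: SilvermanATAEC1994, IV.9.4 Step 9] -/
theorem IIIstarForm.b₄_eq : M.b₄ = 27 * (2 * α₄ + 3 * α₁ * α₃) := by
  rw [WeierstrassCurve.b₄, ha₁, ha₃, ha₄]; ring

omit ha₁ ha₂ ha₄ in
/-- On the `III*` form, `b₆ = 81(9α₃² + 12α₆)`. [cite: SilvermanATAEC1994, IV.9.4 Step 9] -/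
theorem IIIstarForm.b₆_eq : M.b₆ = 81 * (9 * α₃ ^ 2 + 12 * α₆) := by
  rw [WeierstrassCurve.b₆, ha₃, ha₆]; ring

/-- On the `III*` form, `b₈ = 729(3α₁²α₆ + 12α₂α₆ − 3α₁α₃α₄ + 9α₂α₃² − α₄²)`.
[cite: SilvermanATAEC1994, IV.9.4 Step 9] -/
theorem IIIstarForm.b₈_eq : M.b₈ =
    729 * (3 * α₁ ^ 2 * α₆ + 12 * α₂ * α₆ - 3 * α₁ * α₃ * α₄ + 9 * α₂ * α₃ ^ 2 - α₄ ^ 2) := by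
  rw [WeierstrassCurve.b₈, ha₁, ha₂, ha₃, ha₄, ha₆]; ring

omit ha₁ ha₂ ha₃ ha₄ ha₆ in
/-- The `ℤ/3`-computation behind `β₈ ≡ −1`: `β₈ = 3(…) − α₄²` with `α₄ ≢ 0` gives `β₈ + 1 = 0` in
`ℤ/3`. [folklore] -/
theorem zmod3_β₈_add_one (y₁ y₂ y₃ y₄ y₆ : ZMod 3) (h4 : y₄ ≠ 0) :
    3 * y₁ ^ 2 * y₆ + 12 * y₂ * y₆ - 3 * y₁ * y₃ * y₄ + 9 * y₂ * y₃ ^ 2 - y₄ ^ 2 + 1 = 0 := by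
  have h3 : (3 : ZMod 3) = 0 := by decide
  have h12 : (12 : ZMod 3) = 0 := by decide
  have h9 : (9 : ZMod 3) = 0 := by decide
  have key : 3 * y₁ ^ 2 * y₆ + 12 * y₂ * y₆ - 3 * y₁ * y₃ * y₄ + 9 * y₂ * y₃ ^ 2 - y₄ ^ 2 + 1 =
      -y₄ ^ 2 + 1 := by
    rw [h3, h12, h9]; ring
  have aux : ∀ y : ZMod 3, y ≠ 0 → -y ^ 2 + 1 = 0 := by decide
  rw [key]
  exact aux y₄ h4

omit ha₁ ha₂ ha₃ ha₄ ha₆ in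
/-- **On the `III*` form with `a₄ = 27α₄`, `α₄ ∈ ℤ₃ˣ` (i.e. `3⁴ ∤ a₄`): `β₈ = b₈/3⁶` satisfies
`3 ∣ β₈ + 1`.** [folklore] -/
theorem IIIstarForm.three_dvd_β₈_add_one (hα₄ : IsUnit α₄) :
    (3 : ℤ_[3]) ∣
      (3 * α₁ ^ 2 * α₆ + 12 * α₂ * α₆ - 3 * α₁ * α₃ * α₄ + 9 * α₂ * α₃ ^ 2 - α₄ ^ 2) + 1 := by
  rw [three_dvd_iff_toZMod_eq_zero]
  have h4 : PadicInt.toZMod α₄ ≠ 0 := (hα₄.map (PadicInt.toZMod (p := 3))).ne_zero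
  simp only [map_add, map_sub, map_mul, map_pow, map_ofNat, map_one]
  exact zmod3_β₈_add_one _ _ _ _ _ h4

omit ha₁ ha₂ ha₃ ha₄ ha₆ in
/-- `Ψ₃` of the base change to `ℚ₃`, evaluated at `3z` for `z ∈ ℤ₃`, on the coefficients
`b₂ = 9β, b₄ = 27β₄, b₆ = 243β₆, b₈ = 729β₈`: `Ψ₃(3z) = 3⁵ (z⁴ + βz³ + 3β₄z² + 9β₆z + 3β₈)`.
[folklore] -/
theorem eval_Ψ₃_three_mul {β β₄ β₆ β₈ : ℤ_[3]} (hb₂ : M.b₂ = 9 * β) (hb₄ : M.b₄ = 27 * β₄)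
    (hb₆ : M.b₆ = 243 * β₆) (hb₈ : M.b₈ = 729 * β₈) (z : ℤ_[3]) :
    (M.map (algebraMap ℤ_[3] ℚ_[3])).Ψ₃.eval (3 * algebraMap ℤ_[3] ℚ_[3] z) =
      243 * algebraMap ℤ_[3] ℚ_[3]
        (z ^ 4 + β * z ^ 3 + 3 * β₄ * z ^ 2 + 3 * (3 * β₆) * z + 3 * β₈) := by
  simp only [WeierstrassCurve.Ψ₃, WeierstrassCurve.map_b₂, WeierstrassCurve.map_b₄,
    WeierstrassCurve.map_b₆, WeierstrassCurve.map_b₈, eval_add, eval_mul, eval_pow, eval_C, eval_X,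
    eval_ofNat, hb₂, hb₄, hb₆, hb₈, map_add, map_mul, map_pow, map_ofNat]
  ring

omit ha₁ ha₂ ha₃ ha₄ ha₆ in
/-- **On the `III*` form, rootless `Ψ₃` forces `27 ∣ b₂`**: with `b₂ = 9β`, `b₄ = 27β₄`,
`b₆ = 243β₆`, `b₈ = 729β₈`, if `β` were a unit then `w⁴ + βw³ + 3β₄w² + 9β₆w + 3β₈` would have a
Hensel root `w ∈ ℤ₃` and `3w` would be a root of `Ψ₃` in `ℚ₃`. [folklore] -/
theorem three_dvd_of_IIIstarShape_of_forall_not_isRoot {β β₄ β₆ β₈ : ℤ_[3]} (hb₂ : M.b₂ = 9 * β)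
    (hb₄ : M.b₄ = 27 * β₄) (hb₆ : M.b₆ = 243 * β₆) (hb₈ : M.b₈ = 729 * β₈)
    (h : ∀ r : ℚ_[3], ¬ ((M.map (algebraMap ℤ_[3] ℚ_[3])).Ψ₃).IsRoot r) : (3 : ℤ_[3]) ∣ β := by
  by_contra hnd
  have hu : IsUnit β := (isUnit_iff_not_three_dvd _).mpr hnd
  obtain ⟨z, hz⟩ := exists_root_of_unitCubeShape hu β₈ (3 * β₆) β₄
  refine h (3 * algebraMap ℤ_[3] ℚ_[3] z) ?_
  have h243 := eval_Ψ₃_three_mul M hb₂ hb₄ hb₆ hb₈ z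
  rw [hz, map_zero, mul_zero] at h243
  exact h243

end IIIstar

end Summit.BirchSwinnertonDyer.Rank1Residual.GaloisImage.PsiThreeKummer

end
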